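import Mathlib
import HarnessLib
import Summits.Ventures.LatticeQCDFlow.Exactness.SUNStoutLatticeLayer
import Summits.Ventures.LatticeQCDFlow.Exactness.SUNStoutLayerEquivariance
import Summits.Ventures.LatticeQCDFlow.Exactness.EquivariantJacobianGaugeInvariance

/-!
# Every continuous exact Jacobian of the masked `SU(N)` stout layer is a CLASS FUNCTION (gauge invariant), and so is the stout flow's model density

HONEST FRAMING: exact (Metropolis-corrected) sampling algorithms for lattice gauge theory;
figures of merit are autocorrelation/cost numbers at stated couplings and volumes; no
continuum-physics claim.

Venture `LatticeQCDFlow` (cell pub-lqcd), topic `Exactness`; FANOUT row 10 (`eng-equiv`; engine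
`equiv/residual.py` / `flows_jax/layers.py` `SU(N)` stout layer; the engine's unit test "log-det gauge
invariance ≤ 1.1e-14").  NEW WORK of the cell over three tree modules: the stout layer as a measurable
automorphism (`SUNStoutLatticeLayer.exists_measurableEquiv_sunStoutLatticeLayer`), its gauge
EQUIVARIANCE (`SUNStoutLayerEquivariance.isGaugeEquivariant_sunStoutLayer`) and the general principle
"a continuous exact Jacobian of a gauge-equivariant automorphism of `G^E` is gauge invariant"
(`EquivariantJacobianGaugeInvariance.isGaugeInvariant_of_hasJacobian`).  It needs NO Jacobian
construction: whatever continuous nonnegative `j` is certified exact for the layer — Liouville's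
`J` of `SUNStoutLayerJacobian.hasJacobian_sunStoutLatticeLayer`, or the closed form
`∏_{a active} det TopS[1, U, a]` of `SUNStoutLayerJacobianDet` — is a class function.  Nothing is
cited as a fact; no number; no definition.

* **`isGaugeInvariant_jacobian_sunStoutLatticeLayer`** — every `n`, `d`, `L ≥ 1`, every mask meeting
  the frozen-staple hypotheses `h1`–`h6`, every frozen-link coefficient `ρ V e = R e (V|frozen)`
  continuous in the frozen links, invariant under their gauge transformations, with the certificate
  `2(d−1)|R| < 1`: if `j ≥ 0` is continuous and `HasJacobian (⊗_e Haar_{SU(n)}) (stout layer) (ofReal ∘ j)`,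
  then `j(U^g) = j(U)` for every gauge transformation `g`;
* **`isGaugeInvariant_modelDensity_sunStoutLatticeLayer`** — consequently the MODEL DENSITY of the
  stout flow, `(r / j) ∘ Ψ⁻¹` for a gauge-invariant prior density `r` (e.g. product Haar, `r = 1`, or
  any `e^{−β S_W}`), is a class function: the importance weights / acceptance ratios the samplers of
  rows 14 / 16–19 compute through the stout layer are gauge invariant.
-/

noncomputable section

namespace Summit.Ventures.LatticeQCDFlow.Exactness

open Literature.MathematicalPhysics.QuantumFieldTheory
open Literature.MathematicalPhysics.QuantumFieldTheory.Luscher2010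
open MeasureTheory
open scoped Matrix ENNReal

variable {d L n : ℕ} [NeZero L]

/-- **Every continuous exact Jacobian of the masked `SU(N)` stout layer is gauge invariant.** -/
theorem isGaugeInvariant_jacobian_sunStoutLatticeLayer (p : Edge d L → Prop) [DecidablePred p]
    (ρ : GaugeConfig d L (Matrix.specialUnitaryGroup (Fin n) ℂ) → Edge d L → ℝ)
    (R : (e : Edge d L) → ({f : Edge d L // ¬p f} → Matrix.specialUnitaryGroup (Fin n) ℂ) → ℝ)
    (hR : ∀ V e, p e → ρ V e = R e (fun f => V f)) (hRc : ∀ e, p e → Continuous (R e))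
    (hρg : ∀ (g : Site d L → Matrix.specialUnitaryGroup (Fin n) ℂ)
      (V : GaugeConfig d L (Matrix.specialUnitaryGroup (Fin n) ℂ)) (e : Edge d L), p e →
        ρ (gaugeTransform g V) e = ρ V e)
    (h1 : ∀ e, p e → ∀ ν, ν ≠ e.2 → ¬p (e.1.shift e.2, ν))
    (h2 : ∀ e, p e → ∀ ν, ν ≠ e.2 → ¬p (e.1.shift ν, e.2))
    (h3 : ∀ e, p e → ∀ ν, ν ≠ e.2 → ¬p (e.1, ν))
    (h4 : ∀ e, p e → ∀ ν, ν ≠ e.2 → ¬p ((e.1 - Pi.single ν 1).shift e.2, ν))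
    (h5 : ∀ e, p e → ∀ ν, ν ≠ e.2 → ¬p (e.1 - Pi.single ν 1, e.2))
    (h6 : ∀ e, p e → ∀ ν, ν ≠ e.2 → ¬p (e.1 - Pi.single ν 1, ν))
    (hκ : ∀ e y, p e → 2 * (d - 1 : ℝ) * |R e y| < 1)
    {Φ : GaugeConfig d L (Matrix.specialUnitaryGroup (Fin n) ℂ) → GaugeConfig d L (Matrix.specialUnitaryGroup (Fin n) ℂ)}
    (hΦ : Φ = fun (V : GaugeConfig d L (Matrix.specialUnitaryGroup (Fin n) ℂ)) (e : Edge d L) =>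
      if p e then
        (⟨NormedSpace.exp ((ρ V e : ℂ) • suProj (plaquetteLoopSum V e.1 e.2)),
            exp_smul_suProj_mem (ρ V e) (plaquetteLoopSum V e.1 e.2)⟩ :
          Matrix.specialUnitaryGroup (Fin n) ℂ) * V e
      else V e)
    {j : GaugeConfig d L (Matrix.specialUnitaryGroup (Fin n) ℂ) → ℝ} (hj : Continuous j) (hj0 : ∀ U, 0 ≤ j U)
    (h : HasJacobian (Measure.pi fun _ : Edge d L => haarProbability (Matrix.specialUnitaryGroup (Fin n) ℂ)) Φ
      (fun U => ENNReal.ofReal (j U))) :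
    IsGaugeInvariant j := by
  haveI : SecondCountableTopology (Matrix (Fin n) (Fin n) ℂ) :=
    inferInstanceAs (SecondCountableTopology (Fin n → Fin n → ℂ))
  haveI : SecondCountableTopology (Matrix.specialUnitaryGroup (Fin n) ℂ) :=
    Topology.IsEmbedding.subtypeVal.secondCountableTopology
  obtain ⟨Ψ, hΨ⟩ := exists_measurableEquiv_sunStoutLatticeLayer p ρ R hR hRc h1 h2 h3 h4 h5 h6 hκ
  have hequiv : IsGaugeEquivariant (Ψ : GaugeConfig d L (Matrix.specialUnitaryGroup (Fin n) ℂ) →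
      GaugeConfig d L (Matrix.specialUnitaryGroup (Fin n) ℂ)) := by
    rw [hΨ]
    exact isGaugeEquivariant_sunStoutLayer p ρ hρg
  rw [hΦ, ← hΨ] at h
  exact isGaugeInvariant_of_hasJacobian hequiv hj hj0 h

/-- **The stout flow's model density is a class function.**  With the layer presented as the
measurable automorphism `Ψ` (`⇑Ψ =` the stout layer), a continuous exact Jacobian `j ≥ 0` and a
gauge-invariant prior density `r`, the push-forward density `(r / j) ∘ Ψ⁻¹` is gauge invariant. -/
theorem isGaugeInvariant_modelDensity_sunStoutLatticeLayer (p : Edge d L → Prop) [DecidablePred p]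
    (ρ : GaugeConfig d L (Matrix.specialUnitaryGroup (Fin n) ℂ) → Edge d L → ℝ)
    (hρg : ∀ (g : Site d L → Matrix.specialUnitaryGroup (Fin n) ℂ)
      (V : GaugeConfig d L (Matrix.specialUnitaryGroup (Fin n) ℂ)) (e : Edge d L), p e →
        ρ (gaugeTransform g V) e = ρ V e)
    (Ψ : GaugeConfig d L (Matrix.specialUnitaryGroup (Fin n) ℂ) ≃ᵐ GaugeConfig d L (Matrix.specialUnitaryGroup (Fin n) ℂ))
    (hΨ : ⇑Ψ = fun (V : GaugeConfig d L (Matrix.specialUnitaryGroup (Fin n) ℂ)) (e : Edge d L) =>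
      if p e then
        (⟨NormedSpace.exp ((ρ V e : ℂ) • suProj (plaquetteLoopSum V e.1 e.2)),
            exp_smul_suProj_mem (ρ V e) (plaquetteLoopSum V e.1 e.2)⟩ :
          Matrix.specialUnitaryGroup (Fin n) ℂ) * V e
      else V e)
    {j r : GaugeConfig d L (Matrix.specialUnitaryGroup (Fin n) ℂ) → ℝ} (hj : Continuous j) (hj0 : ∀ U, 0 ≤ j U)
    (h : HasJacobian (Measure.pi fun _ : Edge d L => haarProbability (Matrix.specialUnitaryGroup (Fin n) ℂ)) Ψ
      (fun U => ENNReal.ofReal (j U)))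
    (hr : IsGaugeInvariant r) :
    IsGaugeInvariant fun U => r (Ψ.symm U) / j (Ψ.symm U) := by
  haveI : SecondCountableTopology (Matrix (Fin n) (Fin n) ℂ) :=
    inferInstanceAs (SecondCountableTopology (Fin n → Fin n → ℂ))
  haveI : SecondCountableTopology (Matrix.specialUnitaryGroup (Fin n) ℂ) :=
    Topology.IsEmbedding.subtypeVal.secondCountableTopology
  have hequiv : IsGaugeEquivariant (Ψ : GaugeConfig d L (Matrix.specialUnitaryGroup (Fin n) ℂ) →
      GaugeConfig d L (Matrix.specialUnitaryGroup (Fin n) ℂ)) := by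
    rw [hΨ]
    exact isGaugeEquivariant_sunStoutLayer p ρ hρg
  exact isGaugeInvariant_modelDensity_of_hasJacobian hequiv hj hj0 h hr

end Summit.Ventures.LatticeQCDFlow.Exactness

end
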